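import Literature.MathematicalPhysics.QuantumFieldTheory.Balaban1983to89.Node00.OpsYSectDCoords
import Literature.MathematicalPhysics.QuantumFieldTheory.Balaban1983to89.B9Thm312WholeL2
import Literature.MathematicalPhysics.QuantumFieldTheory.Balaban1983to89.B9Thm312WholeLeftStepFrom3131
import Literature.MathematicalPhysics.QuantumFieldTheory.Balaban1983to89.B9Thm312WholeRightStepFrom3131

/-!
# `Balaban1983to89.B9PerturbationLettersAtOne` — [B9] (3.120)–(3.121), (3.130)–(3.131), (3.135)–(3.138): the PERTURBATION LETTERS
# Δ′_π, Δ⁽²⁾_π OF THEOREM 3.12's EXPANSION VANISH AT THE TRIVIAL BACKGROUND `U = 1` — the `U = 1` inhabitants of the four displayed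
# perturbation schemas `StepL2`, `Letters3131`, `Letters3131H`, `Letters3131R` of the N06 certificate at node00-def-Y's pinned letters

T. Bałaban, *Propagators for lattice gauge theories in a background field*, Commun. Math. Phys. **99** (1985) 389–434
[`Balaban1985BackgroundPropagators`, "B9"]; [4] = T. Bałaban, *Propagators and renormalization transformations for lattice gauge
theories. II*, Commun. Math. Phys. **96** (1984) 223–250 [`Balaban1984PropagatorsII`].

statement-level skeleton of published theorems with citation tags; proofs where landed; nothing here is a claim about the Yang–Mills
mass gap

THE PRINTED LOCI (verbatim).  [B9] p. 419, before (3.120): *"Let us consider the quadratic form ⟨A, Δ_U A⟩ …  We write it as a sum of the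
form for the configuration U = 1 (more precisely for the part of Δ_U without the terms containing the field strength) and a remainder"*;
(3.120)–(3.121) p. 420 define Δ′_π as that remainder after the projections; p. 422: *"each operator Δ′_π provides the small factor α₀"*;
(3.135) p. 422: *"Δ⁽²⁾_π = (I − DRG′D\*)Δ⁽²⁾(I − DG′RD\*)"*; p. 407, the sentence before Cor. 3.5: *"There we have proved these theorems for
operators with the external gauge field configuration U = 1."*

THE POINT.  The rows-20–21 binders of the N06 certificate (dag-n06-d, editions 16–17 `…N06AtOpsYNuOfRecordV6EPairMW ∕ MX`) display four
PERTURBATION schemas of dag-n06-l's Theorem-3.12 road, all over the letter record `𝔬12 x` whose fields `Tpi ∕ T2` (Δ′_π, Δ⁽²⁾_π) are PINNED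
(`hTpico12 ∕ hT2co12`) to node00-def-Y's coordinate models `Node00.OpsYSectDCoords.TpicoK ∕ T2coK`:
`hstepL2 : … → B9Thm312WholeL2.StepL2 (𝔬12 x) 1 (H x) (θ2₁₂·(Mα₀)) δK12 U` (block-L² bound of Δ′_π and Δ′_π + Δ⁽²⁾_π),
`hL3131 : … → B9Thm312WholeStepFrom3131.Letters3131 (𝔬12 x) (Ta x) (Ta₂ x) (Tb x) (Tb₂ x) 1 (H x) … (t12·(Mα₀)) δT12 U` (the left split
Δ′_π = T_a + D·T_b with small local majorants), `hL3131H : … → B9Thm312WholeLeftStepFrom3131.Letters3131H (𝔬12 x) (Tb x) (Tb₂ x) …` (the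
Hölder sizes of T_b, T_b₂), `hR3131 : … → B9Thm312WholeRightStepFrom3131.Letters3131R (𝔬12 x) (Ta' x) (Ta₂' x) (Tb' x) (Tb₂' x) …` (the right
split).  AT `U = 1` THEY ARE DEGENERATE: the remainder Δ′_π(1) is ZERO (def-Y `Node00.OpsYSectDE.deltaPiPrimeY_one`, print's "J = 0" at
`U = 1`, for ANY transporters `parS` and ANY `G′`-letter) and so is Δ⁽²⁾_π(1) (`Node00.OpsYSectDE.delta2PiY_one`, given a residual letter
with `Δ⁽²⁾(1) = 0` — the record's `(𝔯 x).Δ2_one`); hence the pinned models vanish at every configuration `U₁` reading `1` (§1), the zero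
operator has every non-negative majorant ∕ block bound (§2), and the four schemas hold at `U₁` with the letters T_a = T_a₂ = T_b = T_b₂ = 0
(resp. T′ = 0) for EVERY size θ, t ≥ 0, every rate, every Hölder block norm `bH` — uniformly in the member, no threshold (§3); §4
bundles the four with the zero letters (the certificate's use: `cfg := fun U => U`, `U₁ = fun _ _ => 1`, pins `hTpico12 x U₁ ∕ hT2co12 x U₁`,
`(𝔯 x).Δ2_one`).

HONEST SCOPE.  DEGENERATE inhabitants by construction: at the trivial background the perturbation IS zero — that is the `U = 1` content of
p. 422's *"each operator Δ′_π provides the small factor α₀"*, not an estimate; nothing of [B9] at curved `U` is asserted (there `StepL2 ∕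
Letters3131` are dag-n06-l's located gaps C-r1g6-1 ∕ G-B9-16, displayed as hypotheses).  What this gives the certificate: an A6 partial
witness — the BODIES of `hstepL2 hL3131 hL3131H hR3131` at `U ↦ 1` are inhabited at every member (referee ref-A's WATCH-JSAT-N06, rows
20–21), nothing about the ∀U-binders over the curved class.  Finite-dimensional bookkeeping over def-Y's two `U = 1` lemmas, n06-d's
coordinate functor and r1's `B11SectG.hasMaj_zero`.  COUNT-NEUTRAL; N06 is NOT discharged; one finite lattice at a time; nothing
continuum, nothing about the mass gap.  Cell `pub-ymgap` (HUMAN RULING D-0062), Track A node N06 [B9], bundle F3 (the `U = 1` obligations,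
Cor. 3.5 ∕ [4]), seat `pub-ymgap-dag-n06-h` (g19), 2026-08-27.
-/

namespace Literature.MathematicalPhysics.QuantumFieldTheory.Balaban1983to89.B9PerturbationLettersAtOne

open Node00 Node00.OpsYSectDCoords B9Thm312Whole B9Thm312WholeClasses B9Thm312WholeL2
open B9Thm312WholeStepFrom3131 B9Thm312WholeLeftStepFrom3131 B9Thm312WholeRightStepFrom3131
open B6KLevelCensusIndexV1 (KIdx)
open B9CoReadingCoords B9CoReadingCoordsH B9CoReadingCoordsS
open B11SectG (BlockNorm HasMaj hasMaj_zero)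
open B9SectDL2Decay (BlockBd blockBd_iff_hasMaj)
open B9Thm34Ext (toB6)

noncomputable section

/-! ## §1 node00-def-Y's pinned models of Δ′_π and Δ⁽²⁾_π vanish at a configuration reading `1` -/

section Models

variable {𝔸 : Type} [NormedRing 𝔸] [NormedAlgebra ℂ 𝔸] [CompleteSpace 𝔸] [FiniteDimensional ℝ 𝔸]
variable {κ : Type} [Fintype κ]
variable {d ℓ : ℕ} {hd : 1 ≤ d + 1} {hL : Odd (ℓ + 1) ∧ 1 < ℓ + 1} {b₀ b₁ : ℝ}

omit [CompleteSpace 𝔸] [FiniteDimensional ℝ 𝔸] in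
/-- the coordinate model of the zero family is zero. [cite: Balaban1985BackgroundPropagators, (3.42) p.397, dictionary] -/
theorem coordOpK_const_zero (b : Module.Basis κ ℝ 𝔸) {S D : Type} :
    coordOpK b (fun _ : D => (0 : (S → 𝔸) →ₗ[ℝ] (S → 𝔸))) = 0 := by
  have h := coordOpK_smul b (0 : ℝ) (fun _ : D => (0 : (S → 𝔸) →ₗ[ℝ] (S → 𝔸)))
  simpa only [smul_zero, zero_smul] using h

/-- ★ **Δ′_π VANISHES AT `U = 1`, IN COORDINATES**: node00-def-Y's pinned model `TpicoK` of Δ′_π (3.121) is `0` at every configuration `U₁`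
reading `1` — for ANY basis, ANY transporters `parS`, ANY `G′`-letter (`Node00.OpsYSectDE.deltaPiPrimeY_one`: print's "J = 0" at `U = 1`).
[cite: Balaban1985BackgroundPropagators, (3.120)–(3.121) pp.419–420, Cor. 3.5 p.407] -/
theorem tpicoK_eq_zero_of_cfg_one (i : KIdx d ℓ hd hL b₀ b₁) (b : Module.Basis κ ℝ 𝔸) (B : B9.Backgrounds) (cfg : B.Cfg → CfgY 𝔸 i)
    (parS : SiteParY 𝔸 i) (Gp : SiteOpY 𝔸 i) {U₁ : B.Cfg} (hU₁ : cfg U₁ = fun _ _ => 1) :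
    TpicoK i b B cfg parS Gp U₁ = 0 := by
  rw [TpicoK, hU₁, deltaPiPrimeY_one, LinearMap.restrictScalars_zero, coordOpK_const_zero, smul_zero]

/-- ★ **Δ⁽²⁾_π VANISHES AT `U = 1`, IN COORDINATES**: the pinned model `T2coK` of Δ⁽²⁾_π (3.135) is `0` at every configuration reading `1`,
for a residual letter with `Δ⁽²⁾(1) = 0` (`Node00.OpsYSectDE.delta2PiY_one`). [cite: Balaban1985BackgroundPropagators, (3.134)–(3.135) p.422, Cor. 3.5 p.407] -/
theorem t2coK_eq_zero_of_cfg_one (i : KIdx d ℓ hd hL b₀ b₁) (b : Module.Basis κ ℝ 𝔸) (B : B9.Backgrounds) (cfg : B.Cfg → CfgY 𝔸 i)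
    (parS : SiteParY 𝔸 i) (Gp : SiteOpY 𝔸 i) {Δ2 : BondOpY 𝔸 i} (hΔ : Δ2 (fun _ _ => 1) = 0) {U₁ : B.Cfg}
    (hU₁ : cfg U₁ = fun _ _ => 1) : T2coK i b B cfg parS Gp Δ2 U₁ = 0 := by
  rw [T2coK, hU₁, delta2PiY_one i parS Gp hΔ, LinearMap.restrictScalars_zero, coordOpK_const_zero, smul_zero]

end Models

/-! ## §2 The zero operator has every non-negative majorant and every non-negative block bound -/

section Zero

variable {G : B6.Geometry} {F₁ F₂ : Type} [AddCommGroup F₁] [Module ℝ F₁] [AddCommGroup F₂] [Module ℝ F₂]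

/-- the zero operator has every non-negative majorant of the [4]-(2.51) shape (r1 `B11SectG.hasMaj_zero` + monotonicity). [cite: Balaban1984PropagatorsII, (2.51) p.232, bookkeeping] -/
theorem hasMaj_zero_of_nonneg (b₁ : BlockNorm G F₁) (b₂ : BlockNorm G F₂) {K : G.Site → G.Site → ℝ} (hK : ∀ a b, 0 ≤ K a b) :
    HasMaj b₁ b₂ (0 : F₁ →ₗ[ℝ] F₂) K :=
  (hasMaj_zero b₁ b₂).mono hK

variable {g : B9.Geometry} [Fintype g.Site] {X₁ X₂ : Type} [Fintype X₁] [Fintype X₂] {R₀ : ℝ} {H₀ : Prop}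

/-- the zero operator has every non-negative block-L² bound (3.46)-shape. [cite: Balaban1985BackgroundPropagators, (3.46) p.398, bookkeeping] -/
theorem blockBd_zero_of_nonneg (blk₁ : X₁ → g.Site) (blk₂ : X₂ → g.Site) {N : g.Site → g.Site → ℝ} (hN : ∀ y y', 0 ≤ N y y') :
    BlockBd (g := toB6 g R₀ H₀) blk₁ blk₂ (0 : (X₁ → ℝ) →ₗ[ℝ] (X₂ → ℝ)) N :=
  (blockBd_iff_hasMaj (g := toB6 g R₀ H₀) blk₁ blk₂ 0 N).2 (hasMaj_zero_of_nonneg _ _ hN)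

end Zero

/-! ## §3 The four perturbation schemas at a letter record PINNED to `TpicoK ∕ T2coK` at a configuration reading `1` -/

section Pins

variable {𝔸 : Type} [NormedRing 𝔸] [NormedAlgebra ℂ 𝔸] [CompleteSpace 𝔸] [FiniteDimensional ℝ 𝔸]
variable {κ : Type} [Fintype κ]
variable {d ℓ : ℕ} {hd : 1 ≤ d + 1} {hL : Odd (ℓ + 1) ∧ 1 < ℓ + 1} {b₀ b₁ : ℝ}
variable {g : B9.Geometry} [Fintype g.Site] {Y Z W : Type} [Fintype W]
variable {R₀ : ℝ} {H₀ : Prop}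

omit [Fintype g.Site] [Fintype W] in
/-- a small local majorant `t·e^{−δd}` is non-negative for `t ≥ 0`. [folklore] -/
private theorem maj_nonneg {t δ : ℝ} (ht : 0 ≤ t) (a b : g.Site) : 0 ≤ t * Real.exp (-(δ * g.dist a b)) :=
  mul_nonneg ht (Real.exp_nonneg _)

omit [Fintype g.Site] [Fintype W] in
/-- the block-L² kernel `θ·(Lʲη)⁻¹(L^{j′}η)⁻¹e^{−δ₁d}` is non-negative for `θ ≥ 0` and non-negative lengths. [folklore] -/
private theorem l2maj_nonneg {θ δ₁ : ℝ} (hθ : 0 ≤ θ) (hlen : ∀ y : g.Site, 0 ≤ g.len y) (y y' : g.Site) :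
    0 ≤ θ * (g.len y)⁻¹ * (g.len y')⁻¹ * Real.exp (-(δ₁ * g.dist y y')) :=
  mul_nonneg (mul_nonneg (mul_nonneg hθ (inv_nonneg.mpr (hlen y))) (inv_nonneg.mpr (hlen y'))) (Real.exp_nonneg _)

omit [Fintype W] in
/-- ★★ **`StepL2` AT THE PINS, AT `U = 1`** — the block-L² perturbation schema of (3.130) ∕ (3.138) (dag-n06-l `B9Thm312WholeL2.StepL2`:
block bounds of Δ′_π and Δ′_π + Δ⁽²⁾_π of size θ·(Lʲη)⁻¹(L^{j′}η)⁻¹e^{−δ₁d}) HOLDS at every configuration `U₁` reading `1`, for EVERY θ ≥ 0 and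
every δ₁, for any letter record whose `Tpi ∕ T2` at `U₁` are node00-def-Y's pinned models: there Δ′_π(1) = 0 = Δ⁽²⁾_π(1).  The `U = 1`
inhabitant of the certificate's displayed `hstepL2` body (degenerate: the perturbation vanishes).
[cite: Balaban1985BackgroundPropagators, (3.120) p.419, (3.130)–(3.131) pp.421–422, (3.135)–(3.138) pp.422–423, Cor. 3.5 p.407] -/
theorem stepL2_of_pins_one (i : KIdx d ℓ hd hL b₀ b₁) (b : Module.Basis κ ℝ 𝔸) (B : B9.Backgrounds) (cfg : B.Cfg → CfgY 𝔸 i)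
    (parS : SiteParY 𝔸 i) (Gp : SiteOpY 𝔸 i) (Δ2 : BondOpY 𝔸 i) (𝔬 : Ops g B (XBK κ i) Y Z W) (U₁ : B.Cfg)
    (hU₁ : cfg U₁ = fun _ _ => 1) (hΔ : Δ2 (fun _ _ => 1) = 0)
    (hTpi : 𝔬.Tpi U₁ = TpicoK i b B cfg parS Gp U₁) (hT2 : 𝔬.T2 U₁ = T2coK i b B cfg parS Gp Δ2 U₁)
    {θ δ₁ : ℝ} (hθ : 0 ≤ θ) (hlen : ∀ y : g.Site, 0 ≤ g.len y) : StepL2 𝔬 R₀ H₀ θ δ₁ U₁ := by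
  have h0 : 𝔬.Tpi U₁ = 0 := by rw [hTpi, tpicoK_eq_zero_of_cfg_one i b B cfg parS Gp hU₁]
  have h2 : 𝔬.T2 U₁ = 0 := by rw [hT2, t2coK_eq_zero_of_cfg_one i b B cfg parS Gp hΔ hU₁]
  refine ⟨?_, ?_⟩
  · rw [h0]; exact blockBd_zero_of_nonneg _ _ (l2maj_nonneg hθ hlen)
  · rw [h0, h2, add_zero]; exact blockBd_zero_of_nonneg _ _ (l2maj_nonneg hθ hlen)

/-- ★★ **`Letters3131` AT THE PINS, AT `U = 1`** — the (3.131) ∕ (3.137) left split Δ′_π = T_a + D·T_b, Δ⁽²⁾_π = T_a₂ + D·T_b₂ with small local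
majorants `t·e^{−δ_T d}` (dag-n06-l `B9Thm312WholeStepFrom3131.Letters3131`) HOLDS at every configuration `U₁` reading `1` for ANY letters
`Ta Ta₂ Tb Tb₂` VANISHING AT `U₁` (in particular the zero letters), EVERY t ≥ 0, every δ_T: both sides of the two splits are `0`.  The `U = 1`
inhabitant of the certificate's displayed `hL3131` body (degenerate).
[cite: Balaban1985BackgroundPropagators, (3.120)–(3.121) pp.419–420, (3.130)–(3.131) pp.421–422, (3.135)–(3.137) pp.422–423, Cor. 3.5 p.407] -/
theorem letters3131_of_pins_one (i : KIdx d ℓ hd hL b₀ b₁) (b : Module.Basis κ ℝ 𝔸) (B : B9.Backgrounds) (cfg : B.Cfg → CfgY 𝔸 i)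
    (parS : SiteParY 𝔸 i) (Gp : SiteOpY 𝔸 i) (Δ2 : BondOpY 𝔸 i) (𝔬 : Ops g B (XBK κ i) Y Z W) (U₁ : B.Cfg)
    (hU₁ : cfg U₁ = fun _ _ => 1) (hΔ : Δ2 (fun _ _ => 1) = 0)
    (hTpi : 𝔬.Tpi U₁ = TpicoK i b B cfg parS Gp U₁) (hT2 : 𝔬.T2 U₁ = T2coK i b B cfg parS Gp Δ2 U₁)
    {Ta Ta₂ : B.Cfg → Module.End ℝ (XBK κ i → ℝ)} {Tb Tb₂ : B.Cfg → (XBK κ i → ℝ) →ₗ[ℝ] (W → ℝ)}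
    (hTa : Ta U₁ = 0) (hTa₂ : Ta₂ U₁ = 0) (hTb : Tb U₁ = 0) (hTb₂ : Tb₂ U₁ = 0)
    {hlen : ∀ y : g.Site, 0 ≤ g.len y} {t δT : ℝ} (ht : 0 ≤ t) :
    Letters3131 𝔬 Ta Ta₂ Tb Tb₂ R₀ H₀ hlen t δT U₁ := by
  have h0 : 𝔬.Tpi U₁ = 0 := by rw [hTpi, tpicoK_eq_zero_of_cfg_one i b B cfg parS Gp hU₁]
  have h2 : 𝔬.T2 U₁ = 0 := by rw [hT2, t2coK_eq_zero_of_cfg_one i b B cfg parS Gp hΔ hU₁]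
  exact
    { split := by rw [h0, hTa, hTb, LinearMap.comp_zero, add_zero]
      split₂ := by rw [h2, hTa₂, hTb₂, LinearMap.comp_zero, add_zero]
      ta := by rw [hTa]; exact hasMaj_zero_of_nonneg _ _ (maj_nonneg ht)
      tb := by rw [hTb]; exact hasMaj_zero_of_nonneg _ _ (maj_nonneg ht)
      ta₂ := by rw [hTa₂]; exact hasMaj_zero_of_nonneg _ _ (maj_nonneg ht)
      tb₂ := by rw [hTb₂]; exact hasMaj_zero_of_nonneg _ _ (maj_nonneg ht) }

omit [CompleteSpace 𝔸] [FiniteDimensional ℝ 𝔸] [Fintype κ] [Fintype W] in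
/-- ★★ **`Letters3131H` FOR LETTERS VANISHING AT `U₁`** — the Hölder sizes of the derivative-carrying parts T_b, T_b₂ into any scalar-field block
norm `bH` (dag-n06-l `B9Thm312WholeLeftStepFrom3131.Letters3131H`) hold at `U₁` for ANY letters with `Tb U₁ = 0 = Tb₂ U₁`, every t ≥ 0, every
δ_T, EVERY `bH`, over any letter record — no pin needed (the schema constrains `Tb ∕ Tb₂` only).  With the zero letters of
`letters3131_of_pins_one` this is the `U = 1` inhabitant of the certificate's displayed `hL3131H` body (degenerate).
[cite: Balaban1985BackgroundPropagators, (3.130)–(3.131) pp.421–422, (3.43) p.398, (3.49) p.399, Cor. 3.5 p.407] -/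
theorem letters3131H_of_eq_zero {B : B9.Backgrounds} {X : Type} [Fintype X] (𝔬 : Ops g B X Y Z W) (U₁ : B.Cfg)
    {Tb Tb₂ : B.Cfg → (X → ℝ) →ₗ[ℝ] (W → ℝ)} (hTb : Tb U₁ = 0) (hTb₂ : Tb₂ U₁ = 0) {hlen : ∀ y : g.Site, 0 ≤ g.len y}
    (bH : BlockNorm (toB6 g R₀ H₀) (W → ℝ)) {t δT : ℝ} (ht : 0 ≤ t) : Letters3131H 𝔬 Tb Tb₂ R₀ H₀ hlen bH t δT U₁ where
  tbH := by rw [hTb]; exact hasMaj_zero_of_nonneg _ _ (maj_nonneg ht)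
  tb₂H := by rw [hTb₂]; exact hasMaj_zero_of_nonneg _ _ (maj_nonneg ht)

/-- ★★ **`Letters3131R` AT THE PINS, AT `U = 1`** — the right split Δ′_π = T_a′ + T_b′·D\*, Δ⁽²⁾_π = T_a₂′ + T_b₂′·D\* with small local majorants
(dag-n06-l `B9Thm312WholeRightStepFrom3131.Letters3131R`) HOLDS at every configuration `U₁` reading `1` for ANY letters vanishing at `U₁`,
every t ≥ 0, every δ_T.  The `U = 1` inhabitant of the certificate's displayed `hR3131` body (degenerate).
[cite: Balaban1985BackgroundPropagators, (3.120)–(3.121) pp.419–420, (3.130)–(3.131) pp.421–422, (3.135)–(3.137) pp.422–423, Cor. 3.5 p.407; Balaban1984PropagatorsII, (2.26) p.228] -/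
theorem letters3131R_of_pins_one (i : KIdx d ℓ hd hL b₀ b₁) (b : Module.Basis κ ℝ 𝔸) (B : B9.Backgrounds) (cfg : B.Cfg → CfgY 𝔸 i)
    (parS : SiteParY 𝔸 i) (Gp : SiteOpY 𝔸 i) (Δ2 : BondOpY 𝔸 i) (𝔬 : Ops g B (XBK κ i) Y Z W) (U₁ : B.Cfg)
    (hU₁ : cfg U₁ = fun _ _ => 1) (hΔ : Δ2 (fun _ _ => 1) = 0)
    (hTpi : 𝔬.Tpi U₁ = TpicoK i b B cfg parS Gp U₁) (hT2 : 𝔬.T2 U₁ = T2coK i b B cfg parS Gp Δ2 U₁)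
    {Ta Ta₂ : B.Cfg → Module.End ℝ (XBK κ i → ℝ)} {Tb Tb₂ : B.Cfg → (W → ℝ) →ₗ[ℝ] (XBK κ i → ℝ)}
    (hTa : Ta U₁ = 0) (hTa₂ : Ta₂ U₁ = 0) (hTb : Tb U₁ = 0) (hTb₂ : Tb₂ U₁ = 0)
    {hlen : ∀ y : g.Site, 0 ≤ g.len y} {t δT : ℝ} (ht : 0 ≤ t) :
    Letters3131R 𝔬 Ta Ta₂ Tb Tb₂ R₀ H₀ hlen t δT U₁ := by
  have h0 : 𝔬.Tpi U₁ = 0 := by rw [hTpi, tpicoK_eq_zero_of_cfg_one i b B cfg parS Gp hU₁]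
  have h2 : 𝔬.T2 U₁ = 0 := by rw [hT2, t2coK_eq_zero_of_cfg_one i b B cfg parS Gp hΔ hU₁]
  exact
    { splitR := by rw [h0, hTa, hTb, LinearMap.zero_comp, add_zero]
      splitR₂ := by rw [h2, hTa₂, hTb₂, LinearMap.zero_comp, add_zero]
      ta := by rw [hTa]; exact hasMaj_zero_of_nonneg _ _ (maj_nonneg ht)
      ta₂ := by rw [hTa₂]; exact hasMaj_zero_of_nonneg _ _ (maj_nonneg ht)
      tb := by rw [hTb]; exact hasMaj_zero_of_nonneg _ _ (maj_nonneg ht)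
      tb₂ := by rw [hTb₂]; exact hasMaj_zero_of_nonneg _ _ (maj_nonneg ht) }

end Pins

/-! ## §4 All four at once with the ZERO letters (the certificate's use: `cfg := fun U => U`, `U₁ = fun _ _ => 1`) -/

section Record

variable {𝔸 : Type} [NormedRing 𝔸] [NormedAlgebra ℂ 𝔸] [CompleteSpace 𝔸] [FiniteDimensional ℝ 𝔸]
variable {κ : Type} [Fintype κ]
variable {d ℓ : ℕ} {hd : 1 ≤ d + 1} {hL : Odd (ℓ + 1) ∧ 1 < ℓ + 1} {b₀ b₁ : ℝ}
variable {g : B9.Geometry} [Fintype g.Site] {Y Z W : Type} [Fintype W]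
variable {R₀ : ℝ} {H₀ : Prop}

/-- ★★★ **THE FOUR PERTURBATION BODIES AT `U = 1` WITH THE ZERO LETTERS**: for a letter record `𝔬` pinned at a configuration `U₁` reading `1`
to `TpicoK ∕ T2coK` over any basis, any transporters `parS`, any `G′`-letter and a residual letter with `Δ⁽²⁾(1) = 0` (the certificate's
`hTpico12 x U₁ ∕ hT2co12 x U₁` with `cfg := fun U => U`, and `(𝔯 x).Δ2_one` — verbatim shapes), non-negative block lengths and sizes
θ, t ≥ 0, any rates, any scalar-field block norm `bH`: `StepL2 𝔬 R₀ H₀ θ δ₁ U₁`, `Letters3131 𝔬 0 0 0 0 …`, `Letters3131H 𝔬 0 0 … bH …`,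
`Letters3131R 𝔬 0 0 0 0 …` — all four displayed perturbation schemas of rows 20–21, inhabited at the trivial background of every member.
[cite: Balaban1985BackgroundPropagators, (3.120)–(3.121) pp.419–420, (3.130)–(3.131) pp.421–422, (3.135)–(3.138) pp.422–423, Cor. 3.5 p.407] -/
theorem perturbationLetters_of_pins_one (i : KIdx d ℓ hd hL b₀ b₁) (b : Module.Basis κ ℝ 𝔸) (B : B9.Backgrounds)
    (cfg : B.Cfg → CfgY 𝔸 i) (parS : SiteParY 𝔸 i) (Gp : SiteOpY 𝔸 i) (Δ2 : BondOpY 𝔸 i) (𝔬 : Ops g B (XBK κ i) Y Z W)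
    (U₁ : B.Cfg) (hU₁ : cfg U₁ = fun _ _ => 1) (hΔ : Δ2 (fun _ _ => 1) = 0)
    (hTpi : 𝔬.Tpi U₁ = TpicoK i b B cfg parS Gp U₁) (hT2 : 𝔬.T2 U₁ = T2coK i b B cfg parS Gp Δ2 U₁)
    (hlen : ∀ y : g.Site, 0 ≤ g.len y) (bH : BlockNorm (toB6 g R₀ H₀) (W → ℝ)) {θ δ₁ t δT : ℝ} (hθ : 0 ≤ θ) (ht : 0 ≤ t) :
    StepL2 𝔬 R₀ H₀ θ δ₁ U₁ ∧
      Letters3131 𝔬 (fun _ => 0) (fun _ => 0) (fun _ => 0) (fun _ => 0) R₀ H₀ hlen t δT U₁ ∧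
        Letters3131H 𝔬 (fun _ => 0) (fun _ => 0) R₀ H₀ hlen bH t δT U₁ ∧
          Letters3131R 𝔬 (fun _ => 0) (fun _ => 0) (fun _ => 0) (fun _ => 0) R₀ H₀ hlen t δT U₁ :=
  ⟨stepL2_of_pins_one i b B cfg parS Gp Δ2 𝔬 U₁ hU₁ hΔ hTpi hT2 hθ hlen,
    letters3131_of_pins_one i b B cfg parS Gp Δ2 𝔬 U₁ hU₁ hΔ hTpi hT2 rfl rfl rfl rfl ht,
    letters3131H_of_eq_zero 𝔬 U₁ rfl rfl bH ht,
    letters3131R_of_pins_one i b B cfg parS Gp Δ2 𝔬 U₁ hU₁ hΔ hTpi hT2 rfl rfl rfl rfl ht⟩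

end Record

end

end Literature.MathematicalPhysics.QuantumFieldTheory.Balaban1983to89.B9PerturbationLettersAtOne
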